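import Literature.IUT.HodgeTheaters.Cor53iFcircHdescIffAutCompatible
import Literature.IUT.HodgeTheaters.Cor53iFcircBijectiveAtOpenEmbedding
import Literature.AnabelianGeometry.AbsoluteAnabelian.NeukirchUchidaUniquenessProofs
import Literature.NumberTheory.GaloisRepresentations.NaturalIrrationalities
import Mathlib.FieldTheory.Normal.Closure
import HarnessLib

/-!
# [IUTchI] Cor 5.3 (i) «respectively ⊚»: for `F/ℚ` NOT normal, `hdesc⊚` FAILS at the open-EMBEDDING carrier `Gal(F̄/K) ↪ G_F`
# (`K` the normal closure) — the side hypothesis {`Normal ℚ F`} of ★ `Cor53iFcircBijectiveAtOpenEmbedding` is NECESSARY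

S. Mochizuki, *Inter-universal Teichmüller theory I*, kurims manuscript (May 2020), §5 Cor 5.3 (i) p. 144 l. 2–11; Example 5.1 (i)
p. 123 l. 33–38 (`π₁(†𝒟^⊛)` «a profinite group corresponding to `C_{F_mod}`» constructed functorially from `π₁(†𝒟^⊚) = Π_{C_K}`, which
it contains as an open subgroup); Def 3.1 (b) p. 61 (`F/F_mod` Galois) ([IUTchI] Cor 5.3 (i) p.144) [claim: Mochizuki2012, status: disputed]
(D-0012 claim key; nothing of the series is asserted; no side taken on [IUTchIII] Cor. 3.12).  [AbsAnab] Thm 1.1.1 (ii) p. 6 (slimness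
of `G_ℚ`; the tree's THEOREM `isSlimGroup_ratAlgEquiv_algebraicClosure`, abc-iut-w4-d016) [cite: MochizukiAbsAnab2004, Thm 1.1.1 (ii) p.6];
[NSW] (12.2.1) = the FACT `NeukirchUchida F` (only in the `⟸` of §3's iff) [cite: NeukirchSchmidtWingberg2008, Thm (12.2.1)].

PROOF-ONLY NV file (cell abc-iut, seat abc-iut-L5-t4 gen 11, row «HDESC⊚-IFF-AUTCOMPATIBLE + NORMAL-NECESSARY@OPEN-EMBEDDING» FILE B;
0 def · 0 instance · 0 notation · no Prop fact).  ★ `Cor53iFcircBijectiveAtOpenEmbedding` proved Cor 5.3 (i) ⊚ «bijective» at EVERY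
open-embedding carrier `ι : H ↪ G_F` modulo FACT {`NeukirchUchida F`} and the EXTRA side hypothesis {`Normal ℚ F`} (not a clause of [IUTchI]
Def 3.1), recording «without normality `AutCompatible ι` can fail» as an unproved remark.  THIS FILE proves it, UNCONDITIONALLY, at the
STAND-IN `G_F` for `π₁(†𝒟^⊛)`:
* §1 `GlobalFrobenioid.hdesc_pushCarrier_iff_autCompatible` — FILE A's `hdesc⊚ ⟺ AutCompatible ι` at the LITERAL push carrier of ★
  `GlobalFrobenioidsPushCarrierGaloisRich` §4, every `Δ`, every record;
* §2 `exists_openEmbedding_range_eq_fixing` (a carrier with image `Gal(F̄/F) ∩ Gal(F̄/K)` EXISTS, `K/ℚ` finite),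
  `exists_intermediateField_finite_normal` (the normal closure of `F/ℚ`: finite, `⊇ F`, `Aut_ℚ(F̄)`-stable),
  `exists_ratAlgEquiv_apply_not_mem_range_of_not_normal` (`F/ℚ` not normal ⟹ some `ρ ∈ Aut_ℚ(F̄)` moves `F`), and the core
  **`not_autCompatible_of_apply_not_mem_range`**: at every carrier with image `Gal(F̄/K)` (`K ⊇ F` finite, `Aut_ℚ(F̄)`-stable) the law
  FAILS — the witness `φ = ι⁻¹ ∘ conj(ρ⁻¹) ∘ ι` would force `φ₀ = conj((ρ g)⁻¹)` on ALL of `G_F` (the discrepancy centralises the open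
  subgroup `Gal(F̄/K)` of the SLIM group `Aut_ℚ(F̄)`), whence every `σ ∈ G_F` fixes `ρ(a) ∉ F` — absurd;
* §3 KNIT **`Cor53.not_hdesc_pushCarrier_of_apply_not_mem_range`** (`hdesc⊚` FALSE there, EVERY `Δ`, EVERY record),
  **`Cor53.exists_openEmbedding_not_hdesc_of_not_normal`**, **`Cor53.normal_of_forall_openEmbedding_hdesc`** (UNCONDITIONAL) and
  **`Cor53.forall_openEmbedding_hdesc_iff_normal_of_neukirchUchida`** (`⟸` = ★ `autCompatible_of_neukirchUchida` + ★
  `hdesc_pushCarrier_of_autCompatible`, FACT {`NeukirchUchida F`}).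
CENSUS READING (count-neutral): at the `G_F` stand-in the side hypothesis {`Normal ℚ F`} is NECESSARY AND (mod NU) SUFFICIENT for `hdesc⊚`
at every open-embedding carrier; a side-free `⊚`-booking needs a carrier with an `F`-core (print's `π₁(C_{F_mod})` built functorially
from `Π_{C_K}`, [IUTchI] Ex 5.1 (i) / [AbsTopII] Cor 3.3), not more Galois theory over `G_F`.  HONEST LABEL: refutable-as-typed at OUR
stand-in carrier ≠ refuted in print; typed ≠ inhabited ≠ proved; a named fact held as hypothesis is bookkeeping; nothing here asserts abc
proved or refuted.
-/

noncomputable section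

namespace Literature.IUT.HodgeTheaters

open CategoryTheory Function Literature.AlgebraicGeometry.Frobenioids Literature.AnabelianGeometry.SemiGraphs
open Literature.AlgebraicGeometry.Frobenioids.QuasiTemperoid Literature.NumberTheory.GaloisRepresentations

/-! ### §1. `hdesc⊚ ⟺ AutCompatible ι` at the LITERAL push carrier -/
/-- **`hdesc⊚ ⟺ AutCompatible ι` at the LITERAL push carrier `ℬ(H)⁰ → CosetCat H → CosetCat G_F → ℬ(G_F)⁰`** of ★
`GlobalFrobenioidsPushCarrierGaloisRich` §4 (`H` profinite Galois-countable, `ι : H → G_F` continuous open — e.g. an open embedding), for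
EVERY divisor data `Δ` and EVERY record (★ `hdesc_pushCarrier_of_autCompatible` and its converse).
([IUTchI] Ex 5.1 (iii) p.125) [cite: MochizukiFrdII2008, Ex 1.3 (ii) p.11] [claim: Mochizuki2012, status: disputed] -/
theorem GlobalFrobenioid.hdesc_pushCarrier_iff_autCompatible (F : Type) [Field F] [NumberField F]
    (H : ProfiniteGrp.{0}) [SecondCountableTopology H] (ι : H →* GalFbar F) (hc : Continuous ι) (ho : IsOpenMap ι)
    {Δ : GlobalDivisorData (absGalGrp F)}
    (𝓕 : GlobalFrobenioid Δ (BaseCat H) (baseToCoset H ⋙ CosetCat.push ι ho ⋙ cosetToBase (absGalGrp F))) :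
    (∀ Θ : BaseCat H ≌ BaseCat H, ∃ ΘB : 𝓕.Base ≌ 𝓕.Base, Nonempty (Θ.functor ⋙ 𝓕.baseMor ≅ 𝓕.baseMor ⋙ ΘB.functor)) ↔
      ∀ φ : H ≃ₜ* H, ∃ (φ₀ : GalFbar F ≃ₜ* GalFbar F) (g : GalFbar F), ∀ x, ι (φ x) = g * φ₀ (ι x) * g⁻¹ := by
  haveI : IsGalois F (Fbar F) := isGalois_fbar F
  haveI : SecondCountableTopology (GalFbar F) := GlobalDivisorData.secondCountableTopology_galFbar F
  haveI := BCat.connectedToBTemp_isEquivalence H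
  haveI := BCat.connectedToBTemp_isEquivalence (absGalGrp F)
  haveI := CosetCat.toConnected_isEquivalence (IsTempered.of_profinite (G := absGalGrp F))
  let j := (cosetToBase (absGalGrp F)).asEquivalence
  refine 𝓕.hdesc_iff_autCompatible (IsTempered.of_profinite (G := H)) (IsTempered.of_profinite (G := absGalGrp F)) ι ho hc
    (baseToCoset H).asEquivalence j.symm ?_
  exact Functor.associator _ _ _ ≪≫ Functor.isoWhiskerLeft _
    (Functor.associator _ _ _ ≪≫ Functor.isoWhiskerLeft _ j.unitIso.symm ≪≫ Functor.rightUnitor _)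

/-! ### §2. NV at the INTENDED carrier class: for `F/ℚ` NOT normal, `AutCompatible ι` FAILS at the open embedding `Gal(F̄/K) ↪ G_F` -/

section NotNormal

variable (F : Type) [Field F] [NumberField F]

/-- **Non-vacuity of the carrier class**: for every subextension `K/ℚ` of `F̄` finite over `ℚ`, there IS an open-embedding carrier
`ι : H ↪ G_F` (`H` profinite; `ι` continuous, open, injective) with image `{σ ∈ G_F | σ|_K = id}` — namely the open subgroup
`Gal(F̄/F) ∩ Gal(F̄/K)` itself (open: preimage of the Krull-open `Gal(F̄/K) ≤ Aut_ℚ(F̄)` under the continuous restriction of scalars).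
([IUTchI] Ex 5.1 (i) p.123) [cite: MochizukiFrdI2008, §0 p.13] [claim: Mochizuki2012, status: disputed] -/
theorem exists_openEmbedding_range_eq_fixing (K : IntermediateField ℚ (Fbar F)) [FiniteDimensional ℚ K] :
    ∃ (H : ProfiniteGrp.{0}) (ι : H →* GalFbar F), Continuous ι ∧ IsOpenMap ι ∧ Injective ι ∧
      ∀ σ : GalFbar F, σ ∈ ι.range ↔ ∀ x : Fbar F, x ∈ K → σ x = x := by
  haveI : IsGalois F (Fbar F) := isGalois_fbar F
  have hr : Continuous (AlgEquiv.restrictScalarsHom ℚ : GalFbar F →* (Fbar F ≃ₐ[ℚ] Fbar F)) :=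
    continuous_restrictScalarsHom
  let V : Subgroup (GalFbar F) := K.fixingSubgroup.comap (AlgEquiv.restrictScalarsHom ℚ)
  have hVo : IsOpen (V : Set (GalFbar F)) := K.fixingSubgroup_isOpen.preimage hr
  have hVc : IsClosed (V : Set (GalFbar F)) := (OpenSubgroup.isClosed ⟨V, hVo⟩)
  let Vc : ClosedSubgroup (absGalGrp F) := ⟨V, hVc⟩
  refine ⟨ProfiniteGrp.ofClosedSubgroup Vc, V.subtype, continuous_subtype_val, hVo.isOpenMap_subtype_val,
    Subtype.val_injective, fun σ => ?_⟩
  constructor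
  · rintro ⟨k, rfl⟩
    exact (IntermediateField.mem_fixingSubgroup_iff _ _).mp k.2
  · intro h
    exact ⟨⟨σ, (IntermediateField.mem_fixingSubgroup_iff _ _).mpr h⟩, rfl⟩

/-- **The normal closure qualifies**: `K :=` the normal closure of `F/ℚ` in `F̄` is finite over `ℚ`, contains `F`, and is stable under
EVERY `ℚ`-automorphism of `F̄`. ([IUTchI] Def 3.1 (b) p.61) [claim: Mochizuki2012, status: disputed] -/
theorem exists_intermediateField_finite_normal :
    ∃ K : IntermediateField ℚ (Fbar F), FiniteDimensional ℚ K ∧ (∀ a : F, algebraMap F (Fbar F) a ∈ K) ∧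
      ∀ (γ : Fbar F ≃ₐ[ℚ] Fbar F) (x : Fbar F), x ∈ K → γ x ∈ K := by
  haveI : IsAlgClosure ℚ (Fbar F) := ⟨inferInstance, Algebra.IsAlgebraic.trans ℚ F (Fbar F)⟩
  refine ⟨IntermediateField.normalClosure ℚ F (Fbar F), inferInstance, fun a => ?_, fun γ x hx => ?_⟩
  · exact AlgHom.fieldRange_le_normalClosure (IsScalarTower.toAlgHom ℚ F (Fbar F)) ⟨a, rfl⟩
  · exact (IntermediateField.normal_iff_forall_map_le'.mp inferInstance γ) ⟨x, hx, rfl⟩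

/-- **`F/ℚ` not normal ⟺ some `ℚ`-automorphism of `F̄` moves `F`** (the direction used here: `¬ Normal ℚ F` gives `ρ ∈ Aut_ℚ(F̄)` and
`a ∈ F` with `ρ(a) ∉ F`; the converse is ★ `exists_algebraMap_eq_of_normal`). ([IUTchI] Def 3.1 (b) p.61) [claim: Mochizuki2012, status: disputed] -/
theorem exists_ratAlgEquiv_apply_not_mem_range_of_not_normal (hF : ¬ Normal ℚ F) :
    ∃ (ρ : Fbar F ≃ₐ[ℚ] Fbar F) (a : F), ρ (algebraMap F (Fbar F) a) ∉ Set.range (algebraMap F (Fbar F)) := by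
  haveI : IsAlgClosure ℚ (Fbar F) := ⟨inferInstance, Algebra.IsAlgebraic.trans ℚ F (Fbar F)⟩
  by_contra h
  push Not at h
  apply hF
  let f : F →ₐ[ℚ] Fbar F := IsScalarTower.toAlgHom ℚ F (Fbar F)
  have hN : Normal ℚ f.fieldRange := by
    refine IntermediateField.normal_iff_forall_map_le'.mpr fun σ => ?_
    rintro _ ⟨x, hx, rfl⟩
    obtain ⟨a, rfl⟩ := (AlgHom.mem_fieldRange (f := f)).mp hx
    obtain ⟨b, hb⟩ := h σ a
    exact (AlgHom.mem_fieldRange (f := f)).mpr ⟨b, hb⟩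
  have e : F ≃ₐ[ℚ] f.fieldRange := AlgEquiv.ofInjectiveField f
  haveI := hN
  exact Normal.of_algEquiv e.symm

/-- **For `F/ℚ` NOT normal the law `AutCompatible ι` FAILS at the open-embedding carrier `Gal(F̄/K) ↪ G_F`**, `K ⊇ F` any subextension of
`F̄` finite over `ℚ` and stable under `Aut_ℚ(F̄)` (e.g. the normal closure), at EVERY carrier `(H, ι)` with that image — UNCONDITIONALLY
(no Neukirch–Uchida).  Witness: `φ := ι⁻¹ ∘ conj(ρ⁻¹) ∘ ι` for `ρ ∈ Aut_ℚ(F̄)` moving `F` (a topological automorphism of `H`, since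
`ρ⁻¹ Gal(F̄/K) ρ = Gal(F̄/K)`).  If `ι ∘ φ = Inn(g) ∘ φ₀ ∘ ι`, then with `c := ρ · g ∈ Aut_ℚ(F̄)` one has `φ₀ = conj(c⁻¹)` on `Gal(F̄/K)`;
for `σ ∈ G_F` the element `σ⁻¹ · c φ₀(σ) c⁻¹` then CENTRALISES the open subgroup `Gal(F̄/K)` of `Aut_ℚ(F̄)`, so is trivial by the
SLIMNESS of `Aut_ℚ(F̄) ≅ G_ℚ` (abc-iut-w4-d016's ★ `isSlimGroup_ratAlgEquiv_algebraicClosure`); hence `φ₀ = conj(c⁻¹)` on all of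
`G_F`, and every `σ ∈ G_F` would fix `ρ(a)` — i.e. `ρ(a) ∈ F`, contradiction.  HONEST: OUR stand-in `G_F` for `π₁(†𝒟^⊛)`; print's
`π₁(C_K) ↪ π₁(C_{F_mod})` carries an `F`-core. ([IUTchI] Cor 5.3 (i) p.144) [cite: MochizukiAbsAnab2004, Thm 1.1.1 (ii) p.6]
[claim: Mochizuki2012, status: disputed] -/
theorem not_autCompatible_of_apply_not_mem_range (K : IntermediateField ℚ (Fbar F)) [FiniteDimensional ℚ K]
    (hKF : ∀ a : F, algebraMap F (Fbar F) a ∈ K)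
    (hKn : ∀ (γ : Fbar F ≃ₐ[ℚ] Fbar F) (x : Fbar F), x ∈ K → γ x ∈ K)
    (ρ : Fbar F ≃ₐ[ℚ] Fbar F) (a : F) (hρa : ρ (algebraMap F (Fbar F) a) ∉ Set.range (algebraMap F (Fbar F)))
    (H : ProfiniteGrp.{0}) (ι : H →* GalFbar F) (hc : Continuous ι) (hinj : Injective ι)
    (hrange : ∀ σ : GalFbar F, σ ∈ ι.range ↔ ∀ x : Fbar F, x ∈ K → σ x = x) :
    ¬ ∀ φ : H ≃ₜ* H, ∃ (φ₀ : GalFbar F ≃ₜ* GalFbar F) (g : GalFbar F), ∀ x, ι (φ x) = g * φ₀ (ι x) * g⁻¹ := by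
  haveI : IsGalois F (Fbar F) := isGalois_fbar F
  haveI : Algebra.IsAlgebraic ℚ (Fbar F) := Algebra.IsAlgebraic.trans ℚ F (Fbar F)
  haveI : T2Space (Fbar F ≃ₐ[ℚ] Fbar F) := krullTopology_t2
  intro hAE
  -- restriction of scalars `r : G_F ↪ Γ := Aut_ℚ(F̄)`, a topological embedding
  set r : GalFbar F →* (Fbar F ≃ₐ[ℚ] Fbar F) := AlgEquiv.restrictScalarsHom ℚ with hrdef
  have hr : Continuous r := continuous_restrictScalarsHom
  have hrx : ∀ (σ : GalFbar F) (x : Fbar F), r σ x = σ x := fun _ _ => rfl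
  have hremb : Topology.IsEmbedding r := (hr.isClosedEmbedding (AlgEquiv.restrictScalarsHom_injective ℚ)).toIsEmbedding
  -- `W := Gal(F̄/K) ≤ Γ`: open; its elements are `F`-linear (`K ⊇ F`) and fix `K`
  have hWo : IsOpen ((K.fixingSubgroup : Subgroup (Fbar F ≃ₐ[ℚ] Fbar F)) : Set (Fbar F ≃ₐ[ℚ] Fbar F)) :=
    K.fixingSubgroup_isOpen
  have hWmem : ∀ w : Fbar F ≃ₐ[ℚ] Fbar F, w ∈ K.fixingSubgroup ↔ ∀ x : Fbar F, x ∈ K → w x = x := fun w =>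
    IntermediateField.mem_fixingSubgroup_iff _ _
  have hWlift : ∀ w : Fbar F ≃ₐ[ℚ] Fbar F, w ∈ K.fixingSubgroup → ∃ k : H, r (ι k) = w := by
    intro w hw
    let σ : GalFbar F := AlgEquiv.ofRingEquiv (f := w.toRingEquiv) fun b => (hWmem w).mp hw _ (hKF b)
    have hσ : σ ∈ ι.range := (hrange σ).mpr fun x hx => (hWmem w).mp hw x hx
    obtain ⟨k, hk⟩ := hσ
    exact ⟨k, by rw [hk]; ext x; rfl⟩
  -- elements of `ι(H)` fix `K`; `ρ`-conjugation
  have hιK : ∀ (k : H) (x : Fbar F), x ∈ K → ι k x = x := fun k => (hrange (ι k)).mp ⟨k, rfl⟩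
  -- the conjugate `ψ τ τ' k := τ' ∘ ι k ∘ τ` (`τ' = τ⁻¹`) as an `F`-automorphism, for `τ ∈ {ρ, ρ⁻¹}`
  have hlin : ∀ (τ τ' : Fbar F ≃ₐ[ℚ] Fbar F), (∀ x, τ' (τ x) = x) → ∀ (k : H) (b : F),
      ((τ.toRingEquiv.trans (ι k).toRingEquiv).trans τ'.toRingEquiv) (algebraMap F (Fbar F) b) = algebraMap F (Fbar F) b := by
    intro τ τ' hτ k b
    change τ' (ι k (τ (algebraMap F (Fbar F) b))) = algebraMap F (Fbar F) b
    rw [hιK k _ (hKn τ _ (hKF b)), hτ]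
  let c₁ : H → GalFbar F := fun k => AlgEquiv.ofRingEquiv (hlin ρ ρ.symm ρ.symm_apply_apply k)
  let c₂ : H → GalFbar F := fun k => AlgEquiv.ofRingEquiv (hlin ρ.symm ρ ρ.apply_symm_apply k)
  have hc₁ : ∀ (k : H) (x : Fbar F), c₁ k x = ρ.symm (ι k (ρ x)) := fun _ _ => rfl
  have hc₂ : ∀ (k : H) (x : Fbar F), c₂ k x = ρ (ι k (ρ.symm x)) := fun _ _ => rfl
  have hc₁mem : ∀ k : H, c₁ k ∈ ι.range := fun k => (hrange _).mpr fun x hx => by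
    rw [hc₁, hιK k _ (hKn ρ x hx), ρ.symm_apply_apply]
  have hc₂mem : ∀ k : H, c₂ k ∈ ι.range := fun k => (hrange _).mpr fun x hx => by
    rw [hc₂, hιK k _ (hKn ρ.symm x hx), ρ.apply_symm_apply]
  choose d₁ hd₁ using hc₁mem
  choose d₂ hd₂ using hc₂mem
  -- `φ := d₁ : H ≃ₜ* H` (inverse `d₂`), continuity through the embedding `r ∘ ι`
  have hιemb : Topology.IsEmbedding (fun k : H => r (ι k)) := hremb.comp (hc.isClosedEmbedding hinj).toIsEmbedding
  have hd₁r : ∀ k : H, r (ι (d₁ k)) = ρ⁻¹ * r (ι k) * ρ := fun k => by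
    rw [hd₁]; ext x; rw [hrx, hc₁, AlgEquiv.mul_apply, AlgEquiv.mul_apply]; rfl
  have hd₂r : ∀ k : H, r (ι (d₂ k)) = ρ * r (ι k) * ρ⁻¹ := fun k => by
    rw [hd₂]; ext x; rw [hrx, hc₂, AlgEquiv.mul_apply, AlgEquiv.mul_apply]; rfl
  have hd₁c : Continuous d₁ := by
    rw [hιemb.continuous_iff]
    simp only [Function.comp_def, hd₁r]
    exact (continuous_const.mul (hr.comp (hc.comp continuous_id))).mul continuous_const
  have hd₂c : Continuous d₂ := by
    rw [hιemb.continuous_iff]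
    simp only [Function.comp_def, hd₂r]
    exact (continuous_const.mul (hr.comp (hc.comp continuous_id))).mul continuous_const
  have hrι : Injective (fun k : H => r (ι k)) := (AlgEquiv.restrictScalarsHom_injective ℚ).comp hinj
  let φ : H ≃ₜ* H :=
    { toFun := d₁
      invFun := d₂
      left_inv := fun k => hrι (by simp only [hd₂r, hd₁r]; group)
      right_inv := fun k => hrι (by simp only [hd₁r, hd₂r]; group)
      map_mul' := fun k k' => hrι (by simp only [map_mul, hd₁r]; group)
      continuous_toFun := hd₁c
      continuous_invFun := hd₂c }
  have hφ : ∀ k : H, r (ι (φ k)) = ρ⁻¹ * r (ι k) * ρ := hd₁r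
  -- the law applied to `φ`
  obtain ⟨φ₀, g, hg⟩ := hAE φ
  -- (★) `r (φ₀ (ι k)) = c⁻¹ · r (ι k) · c` with `c := ρ · r g`
  set c : Fbar F ≃ₐ[ℚ] Fbar F := ρ * r g with hcdef
  have hstar : ∀ k : H, r (φ₀ (ι k)) = c⁻¹ * r (ι k) * c := by
    intro k
    have h1 : φ₀ (ι k) = g⁻¹ * ι (φ k) * g := by rw [hg k]; group
    rw [h1, map_mul, map_mul, map_inv, hφ, hcdef]
    group
  -- (★★) `r (φ₀ σ) = c⁻¹ · r σ · c` for EVERY `σ ∈ G_F`: the discrepancy centralises `Gal(F̄/K)`, so is trivial (slimness of `Aut_ℚ(F̄)`)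
  have hstar2 : ∀ σ : GalFbar F, r (φ₀ σ) = c⁻¹ * r σ * c := by
    intro σ
    -- `d := (r σ)⁻¹ · c · r(φ₀ σ) · c⁻¹` centralises `W`
    have hcent : (r σ)⁻¹ * (c * r (φ₀ σ) * c⁻¹) ∈
        Subgroup.centralizer ((K.fixingSubgroup : Subgroup (Fbar F ≃ₐ[ℚ] Fbar F)) : Set (Fbar F ≃ₐ[ℚ] Fbar F)) := by
      rw [Subgroup.mem_centralizer_iff]
      intro w hw
      obtain ⟨k, hk⟩ := hWlift w hw
      -- `σ · ι k · σ⁻¹ ∈ ι(H)` (the image fixes `K`, which is `G_F`-stable)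
      have hmem : σ * ι k * σ⁻¹ ∈ ι.range := (hrange _).mpr fun x hx => by
        rw [AlgEquiv.mul_apply, AlgEquiv.mul_apply]
        have hx' : σ⁻¹ x ∈ K := by
          have := hKn (r σ⁻¹) x hx
          rwa [hrx] at this
        rw [hιK k _ hx']
        exact (σ : Fbar F ≃ₐ[F] Fbar F).apply_symm_apply x
      obtain ⟨k', hk'⟩ := hmem
      -- `m · r(ιk) · m⁻¹ = rσ · r(ιk) · rσ⁻¹` for `m := c · r(φ₀ σ) · c⁻¹`
      have h2 : r (φ₀ σ) * (c⁻¹ * r (ι k) * c) * (r (φ₀ σ))⁻¹ = c⁻¹ * (r σ * r (ι k) * (r σ)⁻¹) * c := by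
        have h3 := hstar k'
        rw [hk'] at h3
        rw [← hstar k]
        simpa only [map_mul, map_inv] using h3
      rw [← hk]
      calc r (ι k) * ((r σ)⁻¹ * (c * r (φ₀ σ) * c⁻¹))
          = (r σ)⁻¹ * c * (c⁻¹ * (r σ * r (ι k) * (r σ)⁻¹) * c) * r (φ₀ σ) * c⁻¹ := by group
        _ = (r σ)⁻¹ * c * (r (φ₀ σ) * (c⁻¹ * r (ι k) * c) * (r (φ₀ σ))⁻¹) * r (φ₀ σ) * c⁻¹ := by rw [h2]
        _ = (r σ)⁻¹ * (c * r (φ₀ σ) * c⁻¹) * r (ι k) := by group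
    rw [(Literature.AnabelianGeometry.AbsoluteAnabelian.isSlimGroup_ratAlgEquiv_algebraicClosure (F := F)).centralizer_eq_bot
      _ hWo, Subgroup.mem_bot] at hcent
    calc r (φ₀ σ) = c⁻¹ * (r σ * ((r σ)⁻¹ * (c * r (φ₀ σ) * c⁻¹))) * c := by group
      _ = c⁻¹ * r σ * c := by rw [hcent, mul_one]
  -- contradiction: every `σ ∈ G_F` fixes `ρ(a)`, so `ρ(a) ∈ F`
  apply hρa
  have hfix : ∀ σ : GalFbar F, σ (ρ (algebraMap F (Fbar F) a)) = ρ (algebraMap F (Fbar F) a) := by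
    intro σ
    have h1 : r (φ₀ σ) (algebraMap F (Fbar F) a) = algebraMap F (Fbar F) a := by rw [hrx]; exact (φ₀ σ).commutes a
    rw [hstar2 σ, hcdef, AlgEquiv.mul_apply, AlgEquiv.mul_apply] at h1
    -- `h1 : (ρ * r g)⁻¹ (r σ ((ρ * r g) a)) = a`
    have h2 : r σ ((ρ * r g) (algebraMap F (Fbar F) a)) = (ρ * r g) (algebraMap F (Fbar F) a) := by
      rw [← (ρ * r g).apply_symm_apply (r σ ((ρ * r g) (algebraMap F (Fbar F) a)))]
      exact congrArg (ρ * r g) h1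
    rw [AlgEquiv.mul_apply, hrx, hrx, AlgEquiv.commutes] at h2
    exact h2
  have hmem : ρ (algebraMap F (Fbar F) a) ∈ IntermediateField.fixedField (⊥ : IntermediateField F (Fbar F)).fixingSubgroup := by
    rw [IntermediateField.mem_fixedField_iff]
    intro σ _
    exact hfix σ
  rw [InfiniteGalois.fixedField_fixingSubgroup, IntermediateField.mem_bot] at hmem
  exact hmem

end NotNormal

/-! ### §3. KNIT — `hdesc⊚` FALSE at that carrier for every record; SIDE {`Normal ℚ F`} of ★ `Cor53iFcircBijectiveAtOpenEmbedding` is NECESSARY -/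

section Knit

variable (F : Type) [Field F] [NumberField F]

/-- **`hdesc⊚` is FALSE at the open-embedding carrier `Gal(F̄/K) ↪ G_F` when some `ℚ`-automorphism of `F̄` moves `F`** (`K ⊇ F` finite
over `ℚ` and `Aut_ℚ(F̄)`-stable), for EVERY divisor data `Δ` and EVERY `⊚`-record over the LITERAL push carrier of ★
`GlobalFrobenioidsPushCarrierGaloisRich` §4 — by §1 (`hdesc⊚ ⟹ AutCompatible ι`) and §2.  UNCONDITIONAL; OUR stand-in carrier.
([IUTchI] Cor 5.3 (i) p.144) [cite: MochizukiAbsAnab2004, Thm 1.1.1 (ii) p.6] [claim: Mochizuki2012, status: disputed] -/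
theorem Cor53.not_hdesc_pushCarrier_of_apply_not_mem_range (K : IntermediateField ℚ (Fbar F)) [FiniteDimensional ℚ K]
    (hKF : ∀ a : F, algebraMap F (Fbar F) a ∈ K)
    (hKn : ∀ (γ : Fbar F ≃ₐ[ℚ] Fbar F) (x : Fbar F), x ∈ K → γ x ∈ K)
    (ρ : Fbar F ≃ₐ[ℚ] Fbar F) (a : F) (hρa : ρ (algebraMap F (Fbar F) a) ∉ Set.range (algebraMap F (Fbar F)))
    (H : ProfiniteGrp.{0}) (ι : H →* GalFbar F) (hc : Continuous ι) (ho : IsOpenMap ι) (hinj : Injective ι)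
    (hrange : ∀ σ : GalFbar F, σ ∈ ι.range ↔ ∀ x : Fbar F, x ∈ K → σ x = x)
    {Δ : GlobalDivisorData (absGalGrp F)}
    (𝓕 : GlobalFrobenioid Δ (BaseCat H) (baseToCoset H ⋙ CosetCat.push ι ho ⋙ cosetToBase (absGalGrp F))) :
    ¬ ∀ Θ : BaseCat H ≌ BaseCat H, ∃ ΘB : 𝓕.Base ≌ 𝓕.Base, Nonempty (Θ.functor ⋙ 𝓕.baseMor ≅ 𝓕.baseMor ⋙ ΘB.functor) := by
  intro hdesc
  haveI : SecondCountableTopology H := secondCountableTopology_of_openEmbedding F H ι hc hinj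
  exact not_autCompatible_of_apply_not_mem_range F K hKF hKn ρ a hρa H ι hc hinj hrange
    ((GlobalFrobenioid.hdesc_pushCarrier_iff_autCompatible F H ι hc ho 𝓕).mp hdesc)

/-- **For `F/ℚ` NOT normal there is an open-embedding carrier `ι : H ↪ G_F` at which the LAW `AutCompatible ι` FAILS and `hdesc⊚` is
FALSE for EVERY `Δ` and EVERY record** (the carrier `Gal(F̄/K) ↪ G_F`, `K` the normal closure of `F/ℚ`; records exist there by
abc-iut-w4-d050's ★ `nonempty_globalFrobenioid`).  So the SIDE hypothesis {`Normal ℚ F`} of ★ `Cor53iFcircBijectiveAtOpenEmbedding`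
cannot be dropped at the `G_F` stand-in: a SIDE-free `⊚`-booking needs a carrier with an `F`-core (print's `π₁(C_{F_mod})`,
[IUTchI] Ex 5.1 (i)), not more Galois theory over `G_F`.  UNCONDITIONAL. ([IUTchI] Cor 5.3 (i) p.144)
[cite: MochizukiAbsAnab2004, Thm 1.1.1 (ii) p.6] [claim: Mochizuki2012, status: disputed] -/
theorem Cor53.exists_openEmbedding_not_hdesc_of_not_normal (hF : ¬ Normal ℚ F) :
    ∃ (H : ProfiniteGrp.{0}) (ι : H →* GalFbar F) (_ : Continuous ι) (ho : IsOpenMap ι), Injective ι ∧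
      (¬ ∀ φ : H ≃ₜ* H, ∃ (φ₀ : GalFbar F ≃ₜ* GalFbar F) (g : GalFbar F), ∀ x, ι (φ x) = g * φ₀ (ι x) * g⁻¹) ∧
      ∀ {Δ : GlobalDivisorData (absGalGrp F)}
        (𝓕 : GlobalFrobenioid Δ (BaseCat H) (baseToCoset H ⋙ CosetCat.push ι ho ⋙ cosetToBase (absGalGrp F))),
        ¬ ∀ Θ : BaseCat H ≌ BaseCat H, ∃ ΘB : 𝓕.Base ≌ 𝓕.Base,
          Nonempty (Θ.functor ⋙ 𝓕.baseMor ≅ 𝓕.baseMor ⋙ ΘB.functor) := by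
  obtain ⟨K, hKfd, hKF, hKn⟩ := exists_intermediateField_finite_normal F
  haveI := hKfd
  obtain ⟨ρ, a, hρa⟩ := exists_ratAlgEquiv_apply_not_mem_range_of_not_normal F hF
  obtain ⟨H, ι, hc, ho, hinj, hrange⟩ := exists_openEmbedding_range_eq_fixing F K
  exact ⟨H, ι, hc, ho, hinj, not_autCompatible_of_apply_not_mem_range F K hKF hKn ρ a hρa H ι hc hinj hrange,
    fun 𝓕 => Cor53.not_hdesc_pushCarrier_of_apply_not_mem_range F K hKF hKn ρ a hρa H ι hc ho hinj hrange 𝓕⟩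

/-- **`hdesc⊚` at EVERY open-embedding carrier FORCES `F/ℚ` normal** (records over the arithmetic divisor data of [IUTchI] Ex 5.1 (ii)
suffice) — the UNCONDITIONAL necessity of the side hypothesis of ★ `Cor53iFcircBijectiveAtOpenEmbedding` at the `G_F` stand-in.
([IUTchI] Cor 5.3 (i) p.144) [cite: MochizukiAbsAnab2004, Thm 1.1.1 (ii) p.6] [claim: Mochizuki2012, status: disputed] -/
theorem Cor53.normal_of_forall_openEmbedding_hdesc
    (h : ∀ (H : ProfiniteGrp.{0}) (ι : H →* GalFbar F) (_ : Continuous ι) (ho : IsOpenMap ι) (_ : Injective ι)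
      (𝓕 : GlobalFrobenioid (GlobalDivisorData.arith F) (BaseCat H)
        (baseToCoset H ⋙ CosetCat.push ι ho ⋙ cosetToBase (absGalGrp F))),
      ∀ Θ : BaseCat H ≌ BaseCat H, ∃ ΘB : 𝓕.Base ≌ 𝓕.Base, Nonempty (Θ.functor ⋙ 𝓕.baseMor ≅ 𝓕.baseMor ⋙ ΘB.functor)) :
    Normal ℚ F := by
  by_contra hF
  obtain ⟨H, ι, hc, ho, hinj, -, hno⟩ := Cor53.exists_openEmbedding_not_hdesc_of_not_normal F hF
  obtain ⟨𝓕⟩ := nonempty_globalFrobenioid (GlobalDivisorData.arith F) (BaseCat H)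
    (baseToCoset H ⋙ CosetCat.push ι ho ⋙ cosetToBase (absGalGrp F))
  exact hno 𝓕 (h H ι hc ho hinj 𝓕)

/-- **At the `G_F` stand-in, modulo Neukirch–Uchida: `hdesc⊚` at EVERY open-embedding carrier (every record over the arithmetic divisor data)
⟺ `F/ℚ` normal** — `⟸` is ★ `autCompatible_of_neukirchUchida` + ★ `hdesc_pushCarrier_of_autCompatible` (FACT {`NeukirchUchida F`}),
`⟹` is unconditional (§2–§3).  The side hypothesis of ★ p553146's booking is thus NECESSARY AND SUFFICIENT at OUR carrier class; a named
fact held as hypothesis is bookkeeping; no side taken on [IUTchIII] Cor 3.12; nothing here asserts abc proved or refuted.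
([IUTchI] Cor 5.3 (i) p.144) [cite: NeukirchSchmidtWingberg2008, Thm (12.2.1)] [claim: Mochizuki2012, status: disputed] -/
theorem Cor53.forall_openEmbedding_hdesc_iff_normal_of_neukirchUchida (hNU : NeukirchUchida F) :
    (∀ (H : ProfiniteGrp.{0}) (ι : H →* GalFbar F) (_ : Continuous ι) (ho : IsOpenMap ι) (_ : Injective ι)
      (𝓕 : GlobalFrobenioid (GlobalDivisorData.arith F) (BaseCat H)
        (baseToCoset H ⋙ CosetCat.push ι ho ⋙ cosetToBase (absGalGrp F))),
      ∀ Θ : BaseCat H ≌ BaseCat H, ∃ ΘB : 𝓕.Base ≌ 𝓕.Base, Nonempty (Θ.functor ⋙ 𝓕.baseMor ≅ 𝓕.baseMor ⋙ ΘB.functor)) ↔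
      Normal ℚ F := by
  refine ⟨Cor53.normal_of_forall_openEmbedding_hdesc F, fun hN H ι hc ho hinj 𝓕 => ?_⟩
  haveI := hN
  haveI : SecondCountableTopology H := secondCountableTopology_of_openEmbedding F H ι hc hinj
  exact GlobalFrobenioid.hdesc_pushCarrier_of_autCompatible F H ι ho (autCompatible_of_neukirchUchida F H ι hc ho hinj hNU) 𝓕

end Knit

end Literature.IUT.HodgeTheaters

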